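import Mathlib
import Summits.AnomalousDissipation.AnomalousDissipation.Theorems.MarginalStabilityChainStretchedVortexRowsStubRowVorticityConstructionToolsGreenStrip
import Summits.AnomalousDissipation.AnomalousDissipation.Theorems.MarginalStabilityChainStretchedVortexRowsStubRowVorticityConstructionToolsFar

/-!
# Stub `stub_rowVorticityConstruction` (crux stmt-AnomalousDissipation-3009) — tools XI:
# Green's identity for `Φ_ε^L` (assembled) and the total mass `∫_{S_L} ΔΦ_ε^L = 4π`

Helper file (supports stmt-AnomalousDissipation-3009). Fourth brick of the Poisson equation for the cylinder stream
integral. With `(s,t) = 2πq/L`, `D_ε = cosh t − cos s + ε`: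

* `green_strip_reg` — `∫_{S_L} Φ_ε^L(q)(Δω)(p − q) dq = ∫_{S_L} (ΔΦ_ε^L)(q) ω(p − q) dq`,
  `ΔΦ_ε^L = (2π/L)² ε(cosh t + cos s)/D_ε²` (sum of the two parts of tools X and `lap_logKerReg`);
* `∂_{q₂}²Φ_ε^L` and `∂_{q₁}²Φ_ε^L` decay like `e^{−|t|}` (`abs_kerRegU'_le_exp`, `abs_kerRegV'_le_exp`), hence are
  integrable on the strip, and the flux `sinh t/D_ε → ±1` at `t → ±∞` (`tendsto_kerRegU_atTop/atBot`);
* **`integral_lapRowLogKerReg`** — `∫_{S_L} ΔΦ_ε^L = 4π` for every `ε > 0`: by Fubini the `∂_{q₂}²` part integrates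
  along each line to the jump of the flux `(2π/L)(1 − (−1))` (Mathlib `integral_of_hasDerivAt_of_tendsto`), i.e.
  `4π/L` per line and `4π` over the period, while the `∂_{q₁}²` part integrates over each period to
  `∂_{q₁}Φ_ε^L(L/2) − ∂_{q₁}Φ_ε^L(−L/2) = 0`.
Registered sub-goal proved here: `stub_rowVorticityConstruction_regKernelMass`. All `[folklore]`.
-/

set_option linter.dupNamespace false

noncomputable section

open Real Set Filter Topology MeasureTheory
open Literature.Analysis.FluidPDE Literature.Analysis.FluidPDE.StretchedLayer

namespace Summit.AnomalousDissipation.AnomalousDissipation.Theorems.MarginalStabilityChainStretchedVortexRows.RowBiotSavart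

/-! ### Green's identity, assembled -/

section Green

variable {L ε : ℝ} {ω : ℝ → ℝ → ℝ}

/-- **Green's second identity on the strip for the regularised kernel**:
`∫_{S_L} Φ_ε^L(q) (Δω)(x − q₁, y − q₂) dq = ∫_{S_L} (ΔΦ_ε^L)(q) ω(x − q₁, y − q₂) dq`. [folklore] -/
theorem green_strip_reg (hL : 0 < L) (hε : 0 < ε) (hε1 : ε ≤ 1) (hω : ContDiff ℝ 2 fun p : ℝ × ℝ => ω p.1 p.2)
    (hB : ∀ i ≤ 2, ∃ C a : ℝ, 0 < a ∧
      ∀ p, ‖iteratedFDeriv ℝ i (fun p : ℝ × ℝ => ω p.1 p.2) p‖ ≤ C * Real.exp (-a * p.2 ^ 2))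
    (hper : ∀ x y, ω (x + L) y = ω x y) (x y : ℝ) :
    ∫ q in Ioc (-(L / 2)) (L / 2) ×ˢ (univ : Set ℝ),
        Real.log (Real.cosh (2 * π * q.2 / L) - Real.cos (2 * π * q.1 / L) + ε) * lap ω (x - q.1) (y - q.2) =
      ∫ q in Ioc (-(L / 2)) (L / 2) ×ˢ (univ : Set ℝ),
        (2 * π / L) ^ 2 * (ε * (Real.cosh (2 * π * q.2 / L) + Real.cos (2 * π * q.1 / L)) /
          (Real.cosh (2 * π * q.2 / L) - Real.cos (2 * π * q.1 / L) + ε) ^ 2) * ω (x - q.1) (y - q.2) := by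
  have h1 := green_strip_reg_fst hL hε hε1 hω hB hper x y
  have h2 := green_strip_reg_snd hL hε hε1 hω hB x y
  -- integrability of the four integrands (as in tools X)
  obtain ⟨⟨C, a, ha, hb⟩, -⟩ := gaussBounds_of_iterated (ω := ω) fun i hi => hB i (hi.trans one_le_two)
  obtain ⟨C₂, a₂, ha₂, hb₂⟩ := hB 2 le_rfl
  set S : Set (ℝ × ℝ) := Ioc (-(L / 2)) (L / 2) ×ˢ (univ : Set ℝ)
  have mΦ : Measurable fun q : ℝ × ℝ => Real.log (Real.cosh (2 * π * q.2 / L) - Real.cos (2 * π * q.1 / L) + ε) := by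
    fun_prop
  have gtΦ : ∀ c : ℝ, 0 < c → ∀ y₀ : ℝ, Integrable (fun q : ℝ × ℝ =>
      ‖Real.log (Real.cosh (2 * π * q.2 / L) - Real.cos (2 * π * q.1 / L) + ε)‖ * Real.exp (-c * (y₀ - q.2) ^ 2))
      (volume.restrict S) := by
    refine gaussTestable_of_le mΦ (A := |Real.log ε| + 2) (B := 2 * π / L) (D := 0) (by positivity) le_rfl
      fun q _ => ?_
    have h := abs_logKerReg_le_const hε hε1 (2 * π * q.1 / L) (2 * π * q.2 / L)
    have habs : |2 * π * q.2 / L| = 2 * π / L * |q.2| := by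
      rw [abs_div, abs_mul, abs_of_pos hL, abs_of_pos (by positivity : (0:ℝ) < 2 * π)]; ring
    rw [habs] at h; simpa using h
  have iXX : Integrable (fun q : ℝ × ℝ =>
      Real.log (Real.cosh (2 * π * q.2 / L) - Real.cos (2 * π * q.1 / L) + ε) * dX (dX ω) (x - q.1) (y - q.2))
      (volume.restrict S) := by
    have bXX : ∀ p : ℝ × ℝ, ‖(fun p : ℝ × ℝ => dX (dX ω) p.1 p.2) p‖ ≤ C₂ * Real.exp (-a₂ * p.2 ^ 2) := fun p => by
      rw [Real.norm_eq_abs]; exact abs_dX_dX_le hω hb₂ p.1 p.2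
    have := integrable_ker_smul mΦ.aestronglyMeasurable gtΦ (continuous_dX (contDiff_one_dX hω)) ha₂ bXX (x, y)
    simpa only [smul_eq_mul, Prod.fst_sub, Prod.snd_sub] using this
  have iYY : Integrable (fun q : ℝ × ℝ =>
      Real.log (Real.cosh (2 * π * q.2 / L) - Real.cos (2 * π * q.1 / L) + ε) * dY (dY ω) (x - q.1) (y - q.2))
      (volume.restrict S) := by
    have bYY : ∀ p : ℝ × ℝ, ‖(fun p : ℝ × ℝ => dY (dY ω) p.1 p.2) p‖ ≤ C₂ * Real.exp (-a₂ * p.2 ^ 2) := fun p => by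
      rw [Real.norm_eq_abs]; exact abs_dY_dY_le hω hb₂ p.1 p.2
    have := integrable_ker_smul mΦ.aestronglyMeasurable gtΦ (continuous_dY (contDiff_one_dY hω)) ha₂ bYY (x, y)
    simpa only [smul_eq_mul, Prod.fst_sub, Prod.snd_sub] using this
  have bF : ∀ p : ℝ × ℝ, ‖(fun p : ℝ × ℝ => ω p.1 p.2) p‖ ≤ C * Real.exp (-a * p.2 ^ 2) := fun p => by
    rw [Real.norm_eq_abs]; exact hb p.1 p.2
  have iker : ∀ (k : ℝ × ℝ → ℝ) (K : ℝ), Measurable k → (∀ q, |k q| ≤ K) →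
      Integrable (fun q : ℝ × ℝ => k q * ω (x - q.1) (y - q.2)) (volume.restrict S) := by
    intro k K mk hk
    have hK : 0 ≤ K := (abs_nonneg _).trans (hk 0)
    have gt : ∀ c : ℝ, 0 < c → ∀ y₀ : ℝ, Integrable (fun q : ℝ × ℝ => ‖k q‖ * Real.exp (-c * (y₀ - q.2) ^ 2))
        (volume.restrict S) :=
      gaussTestable_of_le mk (A := K) (B := 0) (D := 0) le_rfl le_rfl fun q _ => by simpa using hk q
    have := integrable_ker_smul mk.aestronglyMeasurable gt hω.continuous ha bF (x, y)
    simpa only [smul_eq_mul, Prod.fst_sub, Prod.snd_sub] using this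
  have iU := iker (fun q : ℝ × ℝ => (2 * π / L) ^ 2 * ((Real.cosh (2 * π * q.2 / L) *
      (Real.cosh (2 * π * q.2 / L) - Real.cos (2 * π * q.1 / L) + ε) - Real.sinh (2 * π * q.2 / L) ^ 2) /
      (Real.cosh (2 * π * q.2 / L) - Real.cos (2 * π * q.1 / L) + ε) ^ 2))
    ((2 * π / L) ^ 2 * ((2 + 2 / ε) + (2 + 2 / ε) ^ 2)) (by fun_prop) fun q => by
    rw [abs_mul, abs_of_pos (by positivity : (0:ℝ) < (2 * π / L) ^ 2)]
    exact mul_le_mul_of_nonneg_left (abs_kerRegU'_le_const hε _ _) (by positivity)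
  have iV := iker (fun q : ℝ × ℝ => (2 * π / L) ^ 2 * ((Real.cos (2 * π * q.1 / L) *
      (Real.cosh (2 * π * q.2 / L) - Real.cos (2 * π * q.1 / L) + ε) - Real.sin (2 * π * q.1 / L) ^ 2) /
      (Real.cosh (2 * π * q.2 / L) - Real.cos (2 * π * q.1 / L) + ε) ^ 2))
    ((2 * π / L) ^ 2 * (1 / ε + (1 / ε) ^ 2)) (by fun_prop) fun q => by
    rw [abs_mul, abs_of_pos (by positivity : (0:ℝ) < (2 * π / L) ^ 2)]
    exact mul_le_mul_of_nonneg_left (abs_kerRegV'_le_const hε _ _) (by positivity)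
  -- assemble
  have eL : (fun q : ℝ × ℝ => Real.log (Real.cosh (2 * π * q.2 / L) - Real.cos (2 * π * q.1 / L) + ε) *
      lap ω (x - q.1) (y - q.2)) = fun q =>
      Real.log (Real.cosh (2 * π * q.2 / L) - Real.cos (2 * π * q.1 / L) + ε) * dX (dX ω) (x - q.1) (y - q.2) +
      Real.log (Real.cosh (2 * π * q.2 / L) - Real.cos (2 * π * q.1 / L) + ε) * dY (dY ω) (x - q.1) (y - q.2) := by
    funext q; rw [lap_apply]; ring
  rw [eL, integral_add iXX iYY, h1, h2, ← integral_add iV iU]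
  refine integral_congr_ae (Eventually.of_forall fun q => ?_)
  have := lap_logKerReg hε (2 * π * q.1 / L) (2 * π * q.2 / L)
  simp only
  rw [← this]; ring

end Green

/-! ### Decay of the second derivatives of `Φ_ε` and the flux at infinity -/

section Decay

variable {ε : ℝ}

/-- `∂ₜ²Φ_ε = (1 − (cos s − ε) cosh t)/D_ε²` decays: `|·| ≤ 24 e^{−|t|}` for `|t| ≥ 2`. [folklore] -/
theorem abs_kerRegU'_le_exp (hε : 0 < ε) (hε1 : ε ≤ 1) {t : ℝ} (ht : 2 ≤ |t|) (s : ℝ) :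
    |(Real.cosh t * (Real.cosh t - Real.cos s + ε) - Real.sinh t ^ 2) / (Real.cosh t - Real.cos s + ε) ^ 2| ≤
      24 * Real.exp (-|t|) := by
  have hD := denReg_pos hε s t
  have hD0 := exp_le_den ht s
  have h7 := seven_le_exp ht
  have hnum : Real.cosh t * (Real.cosh t - Real.cos s + ε) - Real.sinh t ^ 2 = 1 - (Real.cos s - ε) * Real.cosh t := by
    nlinarith [Real.cosh_sq t]
  rw [hnum, abs_div, abs_of_pos (pow_pos hD 2), div_le_iff₀ (pow_pos hD 2)]
  have hc : |1 - (Real.cos s - ε) * Real.cosh t| ≤ 1 + 2 * Real.exp |t| := by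
    have h1 : |Real.cos s - ε| ≤ 2 := by
      rw [abs_le]; constructor <;> linarith [Real.neg_one_le_cos s, Real.cos_le_one s]
    have h2 : Real.cosh t ≤ Real.exp |t| := by
      rw [← Real.cosh_abs, Real.cosh_eq]
      have : Real.exp (-|t|) ≤ Real.exp |t| := Real.exp_le_exp.2 (by linarith [abs_nonneg t]); linarith
    calc |1 - (Real.cos s - ε) * Real.cosh t| ≤ |(1:ℝ)| + |(Real.cos s - ε) * Real.cosh t| := abs_sub _ _
      _ = 1 + |Real.cos s - ε| * Real.cosh t := by rw [abs_one, abs_mul, abs_of_pos (Real.cosh_pos t)]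
      _ ≤ 1 + 2 * Real.exp |t| := by nlinarith [Real.cosh_pos t]
  have hDε : 5 / 14 * Real.exp |t| ≤ Real.cosh t - Real.cos s + ε := by linarith
  have h25 : (5 / 14 * Real.exp |t|) ^ 2 ≤ (Real.cosh t - Real.cos s + ε) ^ 2 := pow_le_pow_left₀ (by positivity) hDε 2
  have hmul : Real.exp (-|t|) * Real.exp |t| = 1 := by rw [← Real.exp_add]; simp
  nlinarith [Real.exp_pos (-|t|), Real.exp_pos |t|,
    mul_le_mul_of_nonneg_left h25 (by positivity : (0:ℝ) ≤ 24 * Real.exp (-|t|))]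

/-- `∂ₛ²Φ_ε = ((cos s) cosh t − 1 + ε cos s)/D_ε²` decays: `|·| ≤ 24 e^{−|t|}` for `|t| ≥ 2`. [folklore] -/
theorem abs_kerRegV'_le_exp (hε : 0 < ε) (hε1 : ε ≤ 1) {t : ℝ} (ht : 2 ≤ |t|) (s : ℝ) :
    |(Real.cos s * (Real.cosh t - Real.cos s + ε) - Real.sin s ^ 2) / (Real.cosh t - Real.cos s + ε) ^ 2| ≤
      24 * Real.exp (-|t|) := by
  have hD := denReg_pos hε s t
  have hD0 := exp_le_den ht s
  have h7 := seven_le_exp ht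
  have hnum : Real.cos s * (Real.cosh t - Real.cos s + ε) - Real.sin s ^ 2 = Real.cos s * Real.cosh t - 1 + ε * Real.cos s := by
    nlinarith [Real.sin_sq_add_cos_sq s]
  rw [hnum, abs_div, abs_of_pos (pow_pos hD 2), div_le_iff₀ (pow_pos hD 2)]
  have hc : |Real.cos s * Real.cosh t - 1 + ε * Real.cos s| ≤ 1 + 2 * Real.exp |t| := by
    have h1 := Real.abs_cos_le_one s
    have h2 : Real.cosh t ≤ Real.exp |t| := by
      rw [← Real.cosh_abs, Real.cosh_eq]
      have : Real.exp (-|t|) ≤ Real.exp |t| := Real.exp_le_exp.2 (by linarith [abs_nonneg t]); linarith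
    have h3 : |Real.cos s * Real.cosh t| ≤ Real.exp |t| := by
      rw [abs_mul, abs_of_pos (Real.cosh_pos t)]; nlinarith [Real.cosh_pos t]
    have h4 : |ε * Real.cos s| ≤ 1 := by rw [abs_mul, abs_of_pos hε]; nlinarith
    have h1' : (1:ℝ) ≤ Real.exp |t| := Real.one_le_exp (abs_nonneg t)
    rw [abs_le] at h3 h4 ⊢; constructor <;> linarith [h3.1, h3.2, h4.1, h4.2]
  have hDε : 5 / 14 * Real.exp |t| ≤ Real.cosh t - Real.cos s + ε := by linarith
  have h25 : (5 / 14 * Real.exp |t|) ^ 2 ≤ (Real.cosh t - Real.cos s + ε) ^ 2 := pow_le_pow_left₀ (by positivity) hDε 2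
  have hmul : Real.exp (-|t|) * Real.exp |t| = 1 := by rw [← Real.exp_add]; simp
  nlinarith [Real.exp_pos (-|t|), Real.exp_pos |t|,
    mul_le_mul_of_nonneg_left h25 (by positivity : (0:ℝ) ≤ 24 * Real.exp (-|t|))]

/-- `cosh θ → +∞`. [folklore] -/
theorem tendsto_cosh_atTop' : Tendsto Real.cosh atTop atTop := by
  refine tendsto_atTop_mono (fun θ => ?_) tendsto_id
  have h := Real.hasSum_cosh θ
  have h2 := sum_le_hasSum (Finset.range 2)
    (fun n _ => div_nonneg (by rw [pow_mul]; positivity) (by positivity)) (Real.hasSum_cosh θ)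
  simp only [Finset.sum_range_succ, Finset.sum_range_zero, Nat.factorial, mul_zero, pow_zero,
    Nat.cast_one, div_one, zero_add, mul_one] at h2
  norm_num at h2
  simp only [id]
  nlinarith [sq_nonneg (θ - 1)]

/-- **The flux at `+∞`**: `sinh t/(cosh t − cos s + ε) → 1` as `t → +∞` (`ε ≥ 0`). [folklore] -/
theorem tendsto_kerRegU_atTop {ε : ℝ} (hε : 0 ≤ ε) (s : ℝ) :
    Tendsto (fun t => Real.sinh t / (Real.cosh t - Real.cos s + ε)) atTop (𝓝 1) := by
  -- `sinh/(cosh − c) = 1 + (c − e^{−t})/(cosh t − c)`, `c = cos s − ε`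
  have hden : Tendsto (fun t => Real.cosh t - Real.cos s + ε) atTop atTop :=
    tendsto_atTop_add_const_right _ _ (tendsto_atTop_add_const_right _ _ tendsto_cosh_atTop')
  have hnum : Tendsto (fun t => Real.cos s - ε - Real.exp (-t)) atTop (𝓝 (Real.cos s - ε - 0)) :=
    tendsto_const_nhds.sub Real.tendsto_exp_neg_atTop_nhds_zero
  have h := hnum.div_atTop hden
  have h1 := (tendsto_const_nhds (x := (1:ℝ))).add h
  rw [add_zero] at h1
  refine h1.congr' ?_
  filter_upwards [eventually_gt_atTop (0:ℝ)] with t ht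
  have hD : 0 < Real.cosh t - Real.cos s + ε := by
    have h1 := Real.one_lt_cosh.2 ht.ne'
    have h2 := Real.cos_le_one s
    linarith
  field_simp
  rw [Real.sinh_eq, Real.cosh_eq]
  ring

/-- **The flux at `−∞`**: `sinh t/(cosh t − cos s + ε) → −1` as `t → −∞`. [folklore] -/
theorem tendsto_kerRegU_atBot {ε : ℝ} (hε : 0 ≤ ε) (s : ℝ) :
    Tendsto (fun t => Real.sinh t / (Real.cosh t - Real.cos s + ε)) atBot (𝓝 (-1)) := by
  have h := ((tendsto_kerRegU_atTop hε s).comp tendsto_neg_atBot_atTop).neg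
  refine h.congr fun t => ?_
  simp [Real.sinh_neg, Real.cosh_neg, neg_div]

/-- UNIFORM exponential bound for `∂ₜ²Φ_ε` at fixed `ε`: `|·| ≤ (K_ε + 24) e² e^{−|t|}` for all `t`,
`K_ε = (2 + 2/ε) + (2 + 2/ε)²`. [folklore] -/
theorem abs_kerRegU'_le_exp_all (hε : 0 < ε) (hε1 : ε ≤ 1) (s t : ℝ) :
    |(Real.cosh t * (Real.cosh t - Real.cos s + ε) - Real.sinh t ^ 2) / (Real.cosh t - Real.cos s + ε) ^ 2| ≤
      ((2 + 2 / ε) + (2 + 2 / ε) ^ 2 + 24) * Real.exp 2 * Real.exp (-|t|) := by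
  have hK : 0 ≤ (2 + 2 / ε) + (2 + 2 / ε) ^ 2 := by positivity
  have he : 0 < Real.exp (-|t|) := Real.exp_pos _
  have he2 : (1:ℝ) ≤ Real.exp 2 := Real.one_le_exp (by norm_num)
  rcases le_or_gt 2 |t| with ht | ht
  · have h := abs_kerRegU'_le_exp hε hε1 ht s
    nlinarith [mul_nonneg hK (mul_nonneg (Real.exp_pos 2).le he.le)]
  · have h := abs_kerRegU'_le_const hε s t
    have h1 : 1 ≤ Real.exp 2 * Real.exp (-|t|) := by
      rw [← Real.exp_add]; exact Real.one_le_exp (by linarith)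
    nlinarith [mul_nonneg hK (by linarith : (0:ℝ) ≤ Real.exp 2 * Real.exp (-|t|) - 1)]

/-- UNIFORM exponential bound for `∂ₛ²Φ_ε` at fixed `ε`. [folklore] -/
theorem abs_kerRegV'_le_exp_all (hε : 0 < ε) (hε1 : ε ≤ 1) (s t : ℝ) :
    |(Real.cos s * (Real.cosh t - Real.cos s + ε) - Real.sin s ^ 2) / (Real.cosh t - Real.cos s + ε) ^ 2| ≤
      (1 / ε + (1 / ε) ^ 2 + 24) * Real.exp 2 * Real.exp (-|t|) := by
  have hK : 0 ≤ 1 / ε + (1 / ε) ^ 2 := by positivity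
  have he : 0 < Real.exp (-|t|) := Real.exp_pos _
  have he2 : (1:ℝ) ≤ Real.exp 2 := Real.one_le_exp (by norm_num)
  rcases le_or_gt 2 |t| with ht | ht
  · have h := abs_kerRegV'_le_exp hε hε1 ht s
    nlinarith [mul_nonneg hK (mul_nonneg (Real.exp_pos 2).le he.le)]
  · have h := abs_kerRegV'_le_const hε s t
    have h1 : 1 ≤ Real.exp 2 * Real.exp (-|t|) := by
      rw [← Real.exp_add]; exact Real.one_le_exp (by linarith)
    nlinarith [mul_nonneg hK (by linarith : (0:ℝ) ≤ Real.exp 2 * Real.exp (-|t|) - 1)]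

end Decay

/-! ### The total mass `∫_{S_L} ΔΦ_ε^L = 4π` -/

section Mass

variable {L ε : ℝ}

/-- **Total mass of the approximate identity**: `∫_{S_L} ΔΦ_ε^L(q) dq = 4π` for `0 < ε ≤ 1`, `L > 0`. [folklore] -/
theorem integral_lapRowLogKerReg (hL : 0 < L) (hε : 0 < ε) (hε1 : ε ≤ 1) :
    ∫ q in Ioc (-(L / 2)) (L / 2) ×ˢ (univ : Set ℝ),
        (2 * π / L) ^ 2 * (ε * (Real.cosh (2 * π * q.2 / L) + Real.cos (2 * π * q.1 / L)) /
          (Real.cosh (2 * π * q.2 / L) - Real.cos (2 * π * q.1 / L) + ε) ^ 2) = 4 * π := by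
  set S : Set (ℝ × ℝ) := Ioc (-(L / 2)) (L / 2) ×ˢ (univ : Set ℝ)
  set U'' : ℝ × ℝ → ℝ := fun q => (2 * π / L) ^ 2 * ((Real.cosh (2 * π * q.2 / L) *
      (Real.cosh (2 * π * q.2 / L) - Real.cos (2 * π * q.1 / L) + ε) - Real.sinh (2 * π * q.2 / L) ^ 2) /
      (Real.cosh (2 * π * q.2 / L) - Real.cos (2 * π * q.1 / L) + ε) ^ 2) with hU''
  set V'' : ℝ × ℝ → ℝ := fun q => (2 * π / L) ^ 2 * ((Real.cos (2 * π * q.1 / L) *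
      (Real.cosh (2 * π * q.2 / L) - Real.cos (2 * π * q.1 / L) + ε) - Real.sin (2 * π * q.1 / L) ^ 2) /
      (Real.cosh (2 * π * q.2 / L) - Real.cos (2 * π * q.1 / L) + ε) ^ 2) with hV''
  have habs : ∀ t : ℝ, |2 * π * t / L| = 2 * π / L * |t| := fun t => by
    rw [abs_div, abs_mul, abs_of_pos hL, abs_of_pos (by positivity : (0:ℝ) < 2 * π)]; ring
  -- integrability on the strip (exponential decay in `q₂`)
  have iU : Integrable U'' (volume.restrict S) := by
    refine integrable_strip_of_le_exp (by fun_prop)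
      (A := (2 * π / L) ^ 2 * (((2 + 2 / ε) + (2 + 2 / ε) ^ 2 + 24) * Real.exp 2)) (D := 0) (c := 2 * π / L)
      le_rfl (by positivity) fun q _ => ?_
    have h := abs_kerRegU'_le_exp_all hε hε1 (2 * π * q.1 / L) (2 * π * q.2 / L)
    rw [habs] at h
    simp only [hU'', abs_mul, abs_of_pos (by positivity : (0:ℝ) < (2 * π / L) ^ 2), zero_div, add_zero, neg_mul]
    nlinarith [h, sq_nonneg (2 * π / L)]
  have iV : Integrable V'' (volume.restrict S) := by
    refine integrable_strip_of_le_exp (by fun_prop)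
      (A := (2 * π / L) ^ 2 * ((1 / ε + (1 / ε) ^ 2 + 24) * Real.exp 2)) (D := 0) (c := 2 * π / L)
      le_rfl (by positivity) fun q _ => ?_
    have h := abs_kerRegV'_le_exp_all hε hε1 (2 * π * q.1 / L) (2 * π * q.2 / L)
    rw [habs] at h
    simp only [hV'', abs_mul, abs_of_pos (by positivity : (0:ℝ) < (2 * π / L) ^ 2), zero_div, add_zero, neg_mul]
    nlinarith [h, sq_nonneg (2 * π / L)]
  -- pointwise split of the Laplacian
  have hsplit : (fun q : ℝ × ℝ => (2 * π / L) ^ 2 * (ε * (Real.cosh (2 * π * q.2 / L) + Real.cos (2 * π * q.1 / L)) /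
      (Real.cosh (2 * π * q.2 / L) - Real.cos (2 * π * q.1 / L) + ε) ^ 2)) = fun q => U'' q + V'' q := by
    funext q
    simp only [hU'', hV'']
    rw [← lap_logKerReg hε (2 * π * q.1 / L) (2 * π * q.2 / L)]; ring
  rw [hsplit, integral_add iU iV]
  -- the `∂_{q₂}²` part: `4π/L` on every line
  have hU : ∫ q in S, U'' q = 4 * π := by
    rw [volume_restrict_strip] at iU ⊢
    rw [integral_prod _ iU]
    have hline : ∀ q₁ : ℝ, (∫ t, U'' (q₁, t)) = 4 * π / L := by
      intro q₁
      have hint : Integrable fun t : ℝ => U'' (q₁, t) := by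
        have hc : 0 < 2 * π / L := by positivity
        have hi := (MarginalStabilityChainBurgersLayerLowRe.integrable_kernel hc 0).const_mul
          ((2 * π / L) ^ 2 * (((2 + 2 / ε) + (2 + 2 / ε) ^ 2 + 24) * Real.exp 2))
        refine hi.mono' (by fun_prop : Measurable fun t : ℝ => U'' (q₁, t)).aestronglyMeasurable
          (Eventually.of_forall fun t => ?_)
        have h := abs_kerRegU'_le_exp_all hε hε1 (2 * π * q₁ / L) (2 * π * t / L)
        rw [habs] at h
        rw [Real.norm_eq_abs]
        simp only [hU'', abs_mul, abs_of_pos (by positivity : (0:ℝ) < (2 * π / L) ^ 2), zero_sub, abs_neg]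
        rw [show -(2 * π / L * |t|) = -(2 * π / L) * |t| by ring] at *
        nlinarith [h, sq_nonneg (2 * π / L)]
      have htop : Tendsto (fun t : ℝ => 2 * π / L * (Real.sinh (2 * π * t / L) /
          (Real.cosh (2 * π * t / L) - Real.cos (2 * π * q₁ / L) + ε))) atTop (𝓝 (2 * π / L * 1)) := by
        refine Tendsto.const_mul _ ((tendsto_kerRegU_atTop hε.le (2 * π * q₁ / L)).comp ?_)
        have h0 : Tendsto (fun y : ℝ => y) atTop atTop := tendsto_id
        refine (h0.const_mul_atTop (by positivity : (0:ℝ) < 2 * π / L)).congr fun t => ?_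
        ring
      have hbot : Tendsto (fun t : ℝ => 2 * π / L * (Real.sinh (2 * π * t / L) /
          (Real.cosh (2 * π * t / L) - Real.cos (2 * π * q₁ / L) + ε))) atBot (𝓝 (2 * π / L * (-1))) := by
        refine Tendsto.const_mul _ ((tendsto_kerRegU_atBot hε.le (2 * π * q₁ / L)).comp ?_)
        have h0 : Tendsto (fun y : ℝ => y) atBot atBot := tendsto_id
        refine (h0.const_mul_atBot (by positivity : (0:ℝ) < 2 * π / L)).congr fun t => ?_
        ring
      have h := integral_of_hasDerivAt_of_tendsto (fun t => hasDerivAt_rowKerRegU_snd (L := L) hε q₁ t) hint hbot htop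
      simp only [hU''] at h ⊢
      rw [h]; ring
    simp_rw [hline]
    rw [setIntegral_const, Measure.real, Real.volume_Ioc, ENNReal.toReal_ofReal (by linarith), smul_eq_mul]
    field_simp
    ring
  -- the `∂_{q₁}²` part: `0` over every period
  have hV : ∫ q in S, V'' q = 0 := by
    rw [volume_restrict_strip] at iV ⊢
    rw [integral_prod_symm _ iV]
    have hper : ∀ t : ℝ, (∫ s in Ioc (-(L / 2)) (L / 2), V'' (s, t)) = 0 := by
      intro t
      have hle : -(L / 2) ≤ L / 2 := by linarith
      rw [← intervalIntegral.integral_of_le hle]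
      have hD : ∀ s, 0 < Real.cosh (2 * π * t / L) - Real.cos (2 * π * s / L) + ε := fun s => denReg_pos hε _ _
      have hc : Continuous fun s : ℝ => V'' (s, t) :=
        continuous_const.mul (Continuous.div (by fun_prop) (by fun_prop) fun s => (pow_pos (hD s) 2).ne')
      have h := intervalIntegral.integral_eq_sub_of_hasDerivAt (a := -(L / 2)) (b := L / 2)
        (fun s _ => hasDerivAt_rowKerRegV_fst (L := L) hε s t) (hc.intervalIntegrable _ _)
      simp only [hV''] at h ⊢
      rw [h]
      have hπL : 2 * π * (L / 2) / L = π := by field_simp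
      rw [show 2 * π * -(L / 2) / L = -(2 * π * (L / 2) / L) by ring, Real.sin_neg, Real.cos_neg, hπL, Real.sin_pi]
      simp
    simp_rw [hper]
    simp
  rw [hU, hV, add_zero]

end Mass

end RowBiotSavart

open RowBiotSavart in
/-- **Total mass of the regularised Laplacian on the period strip** (registered on stmt-AnomalousDissipation-3009
as the helper stub `stub_rowVorticityConstruction_regKernelMass` of `stub_rowVorticityConstruction`):
`∫_{S_L} ΔΦ_ε^L = 4π` for `0 < ε ≤ 1`, `L > 0` (`RowBiotSavart.integral_lapRowLogKerReg`). [folklore] -/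
theorem stub_rowVorticityConstruction_regKernelMass :
    ∀ (L ε : ℝ), 0 < L → 0 < ε → ε ≤ 1 →
      ∫ q in Set.Ioc (-(L / 2)) (L / 2) ×ˢ (Set.univ : Set ℝ),
          (2 * Real.pi / L) ^ 2 * (ε * (Real.cosh (2 * Real.pi * q.2 / L) + Real.cos (2 * Real.pi * q.1 / L)) /
            (Real.cosh (2 * Real.pi * q.2 / L) - Real.cos (2 * Real.pi * q.1 / L) + ε) ^ 2) = 4 * Real.pi :=
  fun _ _ hL hε hε1 => integral_lapRowLogKerReg hL hε hε1

end Summit.AnomalousDissipation.AnomalousDissipation.Theorems.MarginalStabilityChainStretchedVortexRows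

end
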